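import Summits.QuantumFields.YangMills.Theorems.BalabanUVNodesN09CentralWindowInverseContinuous
import Summits.QuantumFields.YangMills.Theorems.BalabanUVNodesN09FibreThresholdNullOfCharts
import Summits.QuantumFields.YangMills.Theorems.BalabanUVNodesN09SupportClauseAtRecord

/-!
# NODE N09 [B12] — ROAD A′ AT A FIXED ENVIRONMENT: the coarse window set `W_z = {V | ∀ c, V c ∈ T_c(z)}`, the triangular chart, its Jacobian and the (2.9) deviations
# on it, and THE STRICT MARGIN: on the `χ^{(2.9)}_j`-support of the chart every private coordinate lies STRICTLY inside its central `α`-window, so — under window-interior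
# openness of the one-variable (0.4) average (O-int) — `W_z` is a neighbourhood

Cell `pub-ymgap` (YM-PLAN Track A), width seat `pub-ymgap-dag-n09-w5` g5 (D-0154 ∕ R399 (3a) width seat 5 of node N09), FILE 1a (tools of FILE 1b
`…N09TowerAESocketsOfWindowOpenness`, the tower's a.e. sockets `hΦV hJV`); helper of K1⁹ `StabilityBRunRowsAtRecordR13SepCoPHV` = stmt-QuantumFields-27364 (`--supports`,
`--as helper`, count-neutral).  [I] = [Balaban1987RG1] (CMP 109).  CONSUMED BY NAME: dag-n09-w6 g4's `…N09CentralWindowInverseContinuous` (p631266: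
`continuous_centralWindowFamily`, `continuousOn_triChart_of_leftInverse_record`, `isCompact_imageWindow_record`), dag-n09-w6 g3's `centralWindow_extend` (p627104), dag-n09-w3 g5's
`fluctDevOfRecord_eq_of_avg_eq` (p625076), this seat's g4 `self_mem_centralWindow_of_plaqSmall` ∕ `ε₀_nonneg_of_hord` (p622515), dag-n09-w4 g3's `hχdom_of_hsolν_of_numerics`,
pub-balaban's `T4TriangularFibredChart.apply_triChart_eq_of_forall_mem`.

THE OBJECTS.  One level `j < K` of the record; per-bond inversion data `(T, ϑ, jd)` with the image-window clause `hT : T_c(U) = Ū′(c)(Ωα c U)` and the left-inverse clause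
`hleft` of `exists_perBondCharts_of_forwardLaws` (global `DecidableEq` instance on bonds, as there); `Ωα c U = {g | ∀ i, dist1 (fibreFamily U c (pre U c·g·post U c) i) ≤ α}`.
(O-int) — DISPLAYED, nobody's theorem: «`Ū′(c)(Ωα c U)` is a neighbourhood of `Ū′(c)(g)` for every `g` in the STRICT window» (local openness of the one-variable average at
interior window points; the inverse-function face — dag-n09-w4 g5's non-degeneracy `det_sliceDeriv_ne_zero_of_mem` is its natural supplier); (C-jd) `jd_c(U,·)` continuous on `T_c(U)`.

WHAT IS PROVED (theorems only; 0 def, 0 instance, 0 notation, 0 sorry).  §1 one bond: `rightInverse_of_imageWindow_of_leftInverse` · `inverse_mem_centralWindow_of_imageWindow` ·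
`isOpen_strictCentralWindow` (generic torus) · ★ `imageWindow_mem_nhds_of_windowOpenness` · `windowOpenness_of_map_nhds_eq` ((O-int) from the `map Ū′(c) (𝓝 g) = 𝓝 (Ū′(c) g)` form);
§2 fixed environment `z`: `isClosed_coarseWindow` · `coarseWindow_mem_nhds` · `continuousOn_triChart_coarse` · `continuousOn_triJacobian_coarse` · `avOfRecord_triChart_eq_of_mem_coarseWindow` ·
`fluctDev_triChart_eq_of_mem_coarseWindow` · ★ `continuousOn_fluctDev_triChart_coarse` (on `D ∩ W_z` for any `D` where `V^{(j)}` is continuous — N07's `hcrit`); §3 the margin: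
★★ `strictCentralWindow_inverse_of_chi_ne_zero` (`V₀ ∈ domAlt_{j+1} ∩ W_z`, `χ^{(2.9)}_j(Φ_tri(V₀,z)) ≠ 0` ⇒ every `ϑ_c(z, V₀ c)` STRICTLY inside `Ωα c z`, under the STRICT margin
`(((d+2)L)²∕4)·ε₀ < α`, [B11] `hsolν` and dag-n09-w4 g3's numerics) · ★★ `coarseWindow_mem_nhds_of_chi_ne_zero` (… hence `W_z ∈ 𝓝 V₀` under (O-int)).

HONEST FRAMING.  LOCATED, count-neutral classical topology BY NAME on the tree's typed (0.4) objects; (O-int), (C-jd), `hT`∕`hleft`, `hcrit`, `hsolν` and the numerics are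
DISPLAYED hypotheses, asserted of NO record; NO Jacobian law, NO openness, NO continuity of a density proved; nothing of Bałaban's estimates asserted; no socket discharged by this file
alone (FILE 1b does `hΦV hJV`); `hreg` NOT discharged; N09 NOT discharged; conjunct 1 (Lemma 4) ∕ FLAG №7 untouched; K0⁷ ∕ K1⁹ ∕ K3⁸ NOT closed; counts unmoved (typed 28∕28 ·
discharged 5∕28); no summit statement is proved by this seat; one finite four-torus programme at fixed `ε = L^{−K}` per run — R4 closes the conditional rung `BalabanLadder.UV` only;
NOT continuum ∕ ℝ⁴ ∕ infinite volume ∕ OS; the Yang–Mills mass gap (Clay) is NOT proved by any of this.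
-/

noncomputable section

namespace Summit.QuantumFields.YangMills.BalabanUVNodes.N09StrictWindowMarginAtRecord

open MeasureTheory Set Function Filter Topology
open scoped ENNReal NNReal
open Literature.MathematicalPhysics.QuantumFieldTheory.Balaban1983to89
open Literature.MathematicalPhysics.QuantumFieldTheory.Balaban1983to89.T4Continuum (T4Family)
open Literature.MathematicalPhysics.QuantumFieldTheory.Balaban1983to89.Node00
open Literature.MathematicalPhysics.QuantumFieldTheory.Balaban1983to89.ExpMeanLog (deltaSU)
open Literature.MathematicalPhysics.QuantumFieldTheory.Balaban1983to89.BlockAveraging (Idx)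
open Literature.MathematicalPhysics.QuantumFieldTheory.Balaban1983to89.BlockAveragingHaarAC (centralBond pre post)
open Literature.MathematicalPhysics.QuantumFieldTheory.Balaban1983to89.BlockAveragingEMLHaarAC (fibreFamily)
open Literature.MathematicalPhysics.QuantumFieldTheory.Balaban1983to89.B12ContinuousTransportInvarianceOn (continuous_dist1_SU)
open Literature.MathematicalPhysics.QuantumFieldTheory.Balaban1983to89.T4TriangularFibredChart (apply_triChart_eq_of_forall_mem)
open N09CentralWindowAtRecord (centralWindow_extend)
open N09CentralWindowInverseContinuous (continuous_centralWindowFamily continuousOn_triChart_of_leftInverse_record isCompact_imageWindow_record)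
open N09FibreThresholdNullOfCharts (fluctDevOfRecord_eq_of_avg_eq fieldMeasure_thresholdSet_extendCentralBond_eq_zero)
open N09HregOfPerBondChartsAtRecord (isLocal_avOfRecord centralBond_injective_record)
open N09SupportClauseAtRecord (self_mem_centralWindow_of_plaqSmall ε₀_nonneg_of_hord)
open N09B0RiderAtRecord (hχdom_of_hsolν_of_numerics)
open N09LiftInvariance29AtRecord (succ_le_range_of_lt)

variable {F : T4Family} {N : ℕ} [NeZero N] {K j : ℕ}

/-! ## §1  One bond: right inverse and window membership from `hT` + `hleft`; the strict window is open; (O-int) makes the image window a neighbourhood -/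

/-- From the image-window clause `hT` and the left-inverse clause `hleft` (dag-n09-w6 g3's `exists_perBondCharts_of_forwardLaws`): `ϑ_c(U, ·)` is a RIGHT inverse of the
one-variable average on `T_c(U)`. [cite: Balaban1987RG1, (0.4) p.253 and (2.10) p.267 (bookkeeping)] -/
theorem rightInverse_of_imageWindow_of_leftInverse {α : ℝ}
    (T : PBond (F.P K) (j + 1) → GaugeField (F.P K) j (SU N) → Set (SU N)) (ϑ : PBond (F.P K) (j + 1) → GaugeField (F.P K) j (SU N) → SU N → SU N)
    (hT : ∀ c U, T c U = (fun g => (avOfRecord F N K j).avg (update U (centralBond c) g) c) ''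
        {g : SU N | ∀ i : Idx (F.P K), dist1 (fibreFamily U c (pre U c * g * post U c) i) ≤ α})
    (hleft : ∀ c U g, (∀ i : Idx (F.P K), dist1 (fibreFamily U c (pre U c * g * post U c) i) ≤ α) →
        ϑ c U ((avOfRecord F N K j).avg (update U (centralBond c) g) c) = g) :
    ∀ c U, ∀ v ∈ T c U, (avOfRecord F N K j).avg (update U (centralBond c) (ϑ c U v)) c = v := by
  intro c U v hv
  rw [hT c U] at hv
  obtain ⟨g, hg, rfl⟩ := hv
  show (avOfRecord F N K j).avg (update U (centralBond c) (ϑ c U ((avOfRecord F N K j).avg (update U (centralBond c) g) c))) c =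
    (avOfRecord F N K j).avg (update U (centralBond c) g) c
  rw [hleft c U g hg]

/-- From `hT` + `hleft`: on the image window the inverse takes values IN the central `α`-window, `ϑ_c(U, v) ∈ Ωα c U` for `v ∈ T_c(U)`.
[cite: Balaban1987RG1, (0.4) p.253 and (2.10) p.267 (bookkeeping)] -/
theorem inverse_mem_centralWindow_of_imageWindow {α : ℝ}
    (T : PBond (F.P K) (j + 1) → GaugeField (F.P K) j (SU N) → Set (SU N)) (ϑ : PBond (F.P K) (j + 1) → GaugeField (F.P K) j (SU N) → SU N → SU N)
    (hT : ∀ c U, T c U = (fun g => (avOfRecord F N K j).avg (update U (centralBond c) g) c) ''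
        {g : SU N | ∀ i : Idx (F.P K), dist1 (fibreFamily U c (pre U c * g * post U c) i) ≤ α})
    (hleft : ∀ c U g, (∀ i : Idx (F.P K), dist1 (fibreFamily U c (pre U c * g * post U c) i) ≤ α) →
        ϑ c U ((avOfRecord F N K j).avg (update U (centralBond c) g) c) = g) :
    ∀ c U, ∀ v ∈ T c U, ∀ i : Idx (F.P K), dist1 (fibreFamily U c (pre U c * ϑ c U v * post U c) i) ≤ α := by
  intro c U v hv
  rw [hT c U] at hv
  obtain ⟨g, hg, rfl⟩ := hv
  show ∀ i : Idx (F.P K), dist1 (fibreFamily U c (pre U c * ϑ c U ((avOfRecord F N K j).avg (update U (centralBond c) g) c) * post U c) i) ≤ α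
  rw [hleft c U g hg]
  exact hg

/-- The STRICT central `α`-window `{g | ∀ i, dist1 (fibreFamily U c (pre U c·g·post U c) i) < α}` is OPEN in `SU(N)` (finitely many strict conditions on continuous letters,
dag-n09-w6 g4's `continuous_centralWindowFamily`). [cite: Balaban1987RG1, (0.4) p.253 (bookkeeping)] -/
theorem isOpen_strictCentralWindow {P : Params} (c : PBond P (j + 1)) (U : GaugeField P j (SU N)) (α : ℝ) :
    IsOpen {g : SU N | ∀ i : Idx P, dist1 (fibreFamily U c (pre U c * g * post U c) i) < α} := by
  have hset : {g : SU N | ∀ i : Idx P, dist1 (fibreFamily U c (pre U c * g * post U c) i) < α} =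
      ⋂ i, {g : SU N | dist1 (fibreFamily U c (pre U c * g * post U c) i) < α} := by
    ext g; simp
  rw [hset]
  refine isOpen_iInter_of_finite fun i => ?_
  have h2 : Continuous fun p : GaugeField P j (SU N) × SU N => dist1 (fibreFamily p.1 c (pre p.1 c * p.2 * post p.1 c) i) :=
    continuous_dist1_SU.comp (continuous_centralWindowFamily c i)
  exact (isOpen_lt h2 continuous_const).preimage (Continuous.prodMk_right U)

/-- ★ **UNDER (O-int), THE IMAGE WINDOW IS A NEIGHBOURHOOD OF EVERY COARSE VALUE WHOSE INVERSE LIES STRICTLY INSIDE THE WINDOW.**  (O-int) — DISPLAYED — says: for every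
`g` in the STRICT central `α`-window of `U`, `Ū′(c)(Ωα c U) ∈ 𝓝 (Ū′(c)(g))` (local openness of the one-variable (0.4) average at interior window points).  With `hT`
(`T_c(U) = Ū′(c)(Ωα c U)`) and the right-inverse property: `v ∈ T_c(U)`, `ϑ_c(U,v)` strictly inside ⇒ `T_c(U) ∈ 𝓝 v`. [cite: Balaban1987RG1, (0.4) p.253 and (2.10) p.267] -/
theorem imageWindow_mem_nhds_of_windowOpenness {α : ℝ}
    (T : PBond (F.P K) (j + 1) → GaugeField (F.P K) j (SU N) → Set (SU N)) (ϑ : PBond (F.P K) (j + 1) → GaugeField (F.P K) j (SU N) → SU N → SU N)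
    (hT : ∀ c U, T c U = (fun g => (avOfRecord F N K j).avg (update U (centralBond c) g) c) ''
        {g : SU N | ∀ i : Idx (F.P K), dist1 (fibreFamily U c (pre U c * g * post U c) i) ≤ α})
    (hleft : ∀ c U g, (∀ i : Idx (F.P K), dist1 (fibreFamily U c (pre U c * g * post U c) i) ≤ α) →
        ϑ c U ((avOfRecord F N K j).avg (update U (centralBond c) g) c) = g)
    (hopen : ∀ (c : PBond (F.P K) (j + 1)) (U : GaugeField (F.P K) j (SU N)) (g : SU N),
      (∀ i : Idx (F.P K), dist1 (fibreFamily U c (pre U c * g * post U c) i) < α) →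
        (fun g' => (avOfRecord F N K j).avg (update U (centralBond c) g') c) ''
            {g' : SU N | ∀ i : Idx (F.P K), dist1 (fibreFamily U c (pre U c * g' * post U c) i) ≤ α} ∈
          𝓝 ((avOfRecord F N K j).avg (update U (centralBond c) g) c))
    {c : PBond (F.P K) (j + 1)} {U : GaugeField (F.P K) j (SU N)} {v : SU N} (hv : v ∈ T c U)
    (hstrict : ∀ i : Idx (F.P K), dist1 (fibreFamily U c (pre U c * ϑ c U v * post U c) i) < α) : T c U ∈ 𝓝 v := by
  have h := hopen c U (ϑ c U v) hstrict
  rw [rightInverse_of_imageWindow_of_leftInverse T ϑ hT hleft c U v hv] at h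
  rw [hT c U]
  exact h

/-- (O-int) FROM THE OPEN-MAPPING FORM: if at every strict-window point the one-variable average pushes `𝓝 g` onto `𝓝 (Ū′(c)(g))` (the conclusion of the inverse function
theorem for a non-degenerate derivative), then the image window is a neighbourhood of `Ū′(c)(g)` (the closed window is itself a neighbourhood of `g`).
[cite: Balaban1987RG1, (0.4) p.253 and (2.10) p.267 (bookkeeping)] -/
theorem windowOpenness_of_map_nhds_eq {α : ℝ}
    (hmap : ∀ (c : PBond (F.P K) (j + 1)) (U : GaugeField (F.P K) j (SU N)) (g : SU N),
      (∀ i : Idx (F.P K), dist1 (fibreFamily U c (pre U c * g * post U c) i) < α) →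
        map (fun g' => (avOfRecord F N K j).avg (update U (centralBond c) g') c) (𝓝 g) = 𝓝 ((avOfRecord F N K j).avg (update U (centralBond c) g) c)) :
    ∀ (c : PBond (F.P K) (j + 1)) (U : GaugeField (F.P K) j (SU N)) (g : SU N),
      (∀ i : Idx (F.P K), dist1 (fibreFamily U c (pre U c * g * post U c) i) < α) →
        (fun g' => (avOfRecord F N K j).avg (update U (centralBond c) g') c) ''
            {g' : SU N | ∀ i : Idx (F.P K), dist1 (fibreFamily U c (pre U c * g' * post U c) i) ≤ α} ∈
          𝓝 ((avOfRecord F N K j).avg (update U (centralBond c) g) c) := by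
  intro c U g hg
  rw [← hmap c U g hg]
  have hΩ : {g' : SU N | ∀ i : Idx (F.P K), dist1 (fibreFamily U c (pre U c * g' * post U c) i) ≤ α} ∈ 𝓝 g :=
    mem_of_superset ((isOpen_strictCentralWindow c U α).mem_nhds hg)
      fun g' (hg' : ∀ i : Idx (F.P K), dist1 (fibreFamily U c (pre U c * g' * post U c) i) < α) i => (hg' i).le
  exact image_mem_map hΩ

/-! ## §2  Fixed environment `z`: the coarse window set `W_z = {V | ∀ c, V c ∈ T_c(z)}`, the triangular chart and its Jacobian on it, the (2.9) deviations along it -/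

/-- `W_z = {V | ∀ c, V c ∈ T_c(z)}` is CLOSED (each image window is compact, dag-n09-w6 g4's `isCompact_imageWindow_record`; `α < δ_N`).
[cite: Balaban1987RG1, (0.4) p.253 and (2.10) p.267 (bookkeeping)] -/
theorem isClosed_coarseWindow (hj : j < K) {α : ℝ} (hαδ : α < deltaSU (Fin N))
    (T : PBond (F.P K) (j + 1) → GaugeField (F.P K) j (SU N) → Set (SU N))
    (hT : ∀ c U, T c U = (fun g => (avOfRecord F N K j).avg (update U (centralBond c) g) c) ''
        {g : SU N | ∀ i : Idx (F.P K), dist1 (fibreFamily U c (pre U c * g * post U c) i) ≤ α}) (z : GaugeField (F.P K) j (SU N)) :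
    IsClosed {V : PBond (F.P K) (j + 1) → SU N | ∀ c, V c ∈ T c z} := by
  have hset : {V : PBond (F.P K) (j + 1) → SU N | ∀ c, V c ∈ T c z} = ⋂ c, (fun V : PBond (F.P K) (j + 1) → SU N => V c) ⁻¹' T c z := by
    ext V; simp
  rw [hset]
  exact isClosed_iInter fun c => ((isCompact_imageWindow_record hj hαδ T hT c z).isClosed).preimage (continuous_apply c)

omit [NeZero N] in
/-- If every `T_c(z)` is a neighbourhood of `V₀ c`, then `W_z` is a neighbourhood of `V₀` (finitely many coordinates). [cite: Balaban1987RG1, (2.10) p.267 (bookkeeping)] -/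
theorem coarseWindow_mem_nhds (T : PBond (F.P K) (j + 1) → GaugeField (F.P K) j (SU N) → Set (SU N)) (z : GaugeField (F.P K) j (SU N))
    {V₀ : PBond (F.P K) (j + 1) → SU N} (h : ∀ c, T c z ∈ 𝓝 (V₀ c)) : {V : PBond (F.P K) (j + 1) → SU N | ∀ c, V c ∈ T c z} ∈ 𝓝 V₀ := by
  have h' : ∀ c, ∀ᶠ V in 𝓝 V₀, V c ∈ T c z := fun c => (continuous_apply c).continuousAt.preimage_mem_nhds (h c)
  exact eventually_all.2 h'

/-- `Φ_tri(·, z) : V ↦ extend β (c ↦ ϑ_c(z, V c)) z` is continuous on `W_z` (dag-n09-w6 g4's `continuousOn_triChart_of_leftInverse_record`, sliced at `z`; `α < δ_N`).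
[cite: Balaban1987RG1, (2.10) p.267; BourbakiGT1, Ch. I §9 no. 4, Thm 2 Cor. 2] -/
theorem continuousOn_triChart_coarse (hj : j < K) {α : ℝ} (hαδ : α < deltaSU (Fin N))
    (T : PBond (F.P K) (j + 1) → GaugeField (F.P K) j (SU N) → Set (SU N)) (ϑ : PBond (F.P K) (j + 1) → GaugeField (F.P K) j (SU N) → SU N → SU N)
    (hT : ∀ c U, T c U = (fun g => (avOfRecord F N K j).avg (update U (centralBond c) g) c) ''
        {g : SU N | ∀ i : Idx (F.P K), dist1 (fibreFamily U c (pre U c * g * post U c) i) ≤ α})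
    (hleft : ∀ c U g, (∀ i : Idx (F.P K), dist1 (fibreFamily U c (pre U c * g * post U c) i) ≤ α) →
        ϑ c U ((avOfRecord F N K j).avg (update U (centralBond c) g) c) = g) (z : GaugeField (F.P K) j (SU N)) :
    ContinuousOn (fun V : PBond (F.P K) (j + 1) → SU N => (extend centralBond (fun c => ϑ c z (V c)) z : GaugeField (F.P K) j (SU N)))
      {V : PBond (F.P K) (j + 1) → SU N | ∀ c, V c ∈ T c z} :=
  (continuousOn_triChart_of_leftInverse_record hj hαδ T ϑ hT hleft).comp (continuous_id.prodMk continuous_const).continuousOn fun _ hV => hV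

omit [NeZero N] in
/-- (C-jd) ⇒ the triangular Jacobian `V ↦ ∏_c jd_c(z, V c)` is continuous on `W_z`. [cite: Balaban1987RG1, (2.10) p.267 (bookkeeping)] -/
theorem continuousOn_triJacobian_coarse (T : PBond (F.P K) (j + 1) → GaugeField (F.P K) j (SU N) → Set (SU N))
    (jd : PBond (F.P K) (j + 1) → GaugeField (F.P K) j (SU N) → SU N → ℝ≥0) (hjc : ∀ c U, ContinuousOn (jd c U) (T c U)) (z : GaugeField (F.P K) j (SU N)) :
    ContinuousOn (fun V : PBond (F.P K) (j + 1) → SU N => ∏ c, jd c z (V c)) {V : PBond (F.P K) (j + 1) → SU N | ∀ c, V c ∈ T c z} :=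
  continuousOn_finsetProd _ fun c _ => (hjc c z).comp (continuous_apply c).continuousOn fun _ hV => hV c

/-- On `W_z` the triangular chart lies over the coarse variable: `Ū(Φ_tri(V, z)) = V` (`T4TriangularFibredChart.apply_triChart_eq_of_forall_mem` with the right-inverse property of
§1; `j < K`). [cite: Balaban1987RG1, (2.4) p.266 and (2.10) p.267 (bookkeeping)] -/
theorem avOfRecord_triChart_eq_of_mem_coarseWindow (hj : j < K) {α : ℝ}
    (T : PBond (F.P K) (j + 1) → GaugeField (F.P K) j (SU N) → Set (SU N)) (ϑ : PBond (F.P K) (j + 1) → GaugeField (F.P K) j (SU N) → SU N → SU N)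
    (hT : ∀ c U, T c U = (fun g => (avOfRecord F N K j).avg (update U (centralBond c) g) c) ''
        {g : SU N | ∀ i : Idx (F.P K), dist1 (fibreFamily U c (pre U c * g * post U c) i) ≤ α})
    (hleft : ∀ c U g, (∀ i : Idx (F.P K), dist1 (fibreFamily U c (pre U c * g * post U c) i) ≤ α) →
        ϑ c U ((avOfRecord F N K j).avg (update U (centralBond c) g) c) = g)
    (z : GaugeField (F.P K) j (SU N)) {V : PBond (F.P K) (j + 1) → SU N} (hV : ∀ c, V c ∈ T c z) :
    (avOfRecord F N K j).avg (extend centralBond (fun c => ϑ c z (V c)) z) = V :=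
  apply_triChart_eq_of_forall_mem T ϑ (isLocal_avOfRecord hj) (centralBond_injective_record hj)
    (rightInverse_of_imageWindow_of_leftInverse T ϑ hT hleft) hV

/-- On `W_z` the (2.9) deviation of `Φ_tri(V, z)` at a bond `b` reads `dist1 (V^{(j)}(V)(b)⁻¹ · Φ_tri(V,z)(b))` — the critical configuration is read over `V` itself
(dag-n09-w3 g5's `fluctDevOfRecord_eq_of_avg_eq`). [cite: Balaban1987RG1, (2.1) p.265 and (2.9) p.266] -/
theorem fluctDev_triChart_eq_of_mem_coarseWindow (ν : Stage7Numerics) (hj : j < K) {α : ℝ}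
    (T : PBond (F.P K) (j + 1) → GaugeField (F.P K) j (SU N) → Set (SU N)) (ϑ : PBond (F.P K) (j + 1) → GaugeField (F.P K) j (SU N) → SU N → SU N)
    (hT : ∀ c U, T c U = (fun g => (avOfRecord F N K j).avg (update U (centralBond c) g) c) ''
        {g : SU N | ∀ i : Idx (F.P K), dist1 (fibreFamily U c (pre U c * g * post U c) i) ≤ α})
    (hleft : ∀ c U g, (∀ i : Idx (F.P K), dist1 (fibreFamily U c (pre U c * g * post U c) i) ≤ α) →
        ϑ c U ((avOfRecord F N K j).avg (update U (centralBond c) g) c) = g)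
    (z : GaugeField (F.P K) j (SU N)) {V : PBond (F.P K) (j + 1) → SU N} (hV : ∀ c, V c ∈ T c z) (b : PBond (F.P K) j) :
    fluctDevOfRecord F N ν K j (extend centralBond (fun c => ϑ c z (V c)) z) b =
      dist1 ((critCfgOfRecord F N ν K j V b)⁻¹ * (extend centralBond (fun c => ϑ c z (V c)) z : GaugeField (F.P K) j (SU N)) b) :=
  fluctDevOfRecord_eq_of_avg_eq ν K j (avOfRecord_triChart_eq_of_mem_coarseWindow hj T ϑ hT hleft z hV) b

/-- ★ **THE (2.9) DEVIATIONS ALONG THE TRIANGULAR CHART ARE CONTINUOUS IN THE COARSE FIELD on `D ∩ W_z`**, for any set `D` of coarse fields on which the critical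
configuration `V ↦ V^{(j)}(V)` is continuous (N07's `hcrit` on `domAlt_{j+1}`): continuity of `Φ_tri(·,z)` on `W_z`, of `V^{(j)}` on `D`, of `dist1`, inversion and multiplication.
[cite: Balaban1987RG1, (2.1) p.265, (2.3) p.265 and (2.9) p.266; Balaban1985Variational, Thm 1 (8)–(10) p.279] -/
theorem continuousOn_fluctDev_triChart_coarse (ν : Stage7Numerics) (hj : j < K) {α : ℝ} (hαδ : α < deltaSU (Fin N))
    (T : PBond (F.P K) (j + 1) → GaugeField (F.P K) j (SU N) → Set (SU N)) (ϑ : PBond (F.P K) (j + 1) → GaugeField (F.P K) j (SU N) → SU N → SU N)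
    (hT : ∀ c U, T c U = (fun g => (avOfRecord F N K j).avg (update U (centralBond c) g) c) ''
        {g : SU N | ∀ i : Idx (F.P K), dist1 (fibreFamily U c (pre U c * g * post U c) i) ≤ α})
    (hleft : ∀ c U g, (∀ i : Idx (F.P K), dist1 (fibreFamily U c (pre U c * g * post U c) i) ≤ α) →
        ϑ c U ((avOfRecord F N K j).avg (update U (centralBond c) g) c) = g)
    {D : Set (PBond (F.P K) (j + 1) → SU N)} (hcrit : ContinuousOn (critCfgOfRecord F N ν K j) D) (z : GaugeField (F.P K) j (SU N)) (b : PBond (F.P K) j) :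
    ContinuousOn (fun V : PBond (F.P K) (j + 1) → SU N => fluctDevOfRecord F N ν K j (extend centralBond (fun c => ϑ c z (V c)) z) b)
      (D ∩ {V : PBond (F.P K) (j + 1) → SU N | ∀ c, V c ∈ T c z}) := by
  have hΦ : ContinuousOn (fun V : PBond (F.P K) (j + 1) → SU N => (extend centralBond (fun c => ϑ c z (V c)) z : GaugeField (F.P K) j (SU N)) b)
      (D ∩ {V : PBond (F.P K) (j + 1) → SU N | ∀ c, V c ∈ T c z}) :=
    ((continuous_apply b).comp_continuousOn (continuousOn_triChart_coarse hj hαδ T ϑ hT hleft z)).mono inter_subset_right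
  have hC : ContinuousOn (fun V : PBond (F.P K) (j + 1) → SU N => (critCfgOfRecord F N ν K j V b)⁻¹) (D ∩ {V : PBond (F.P K) (j + 1) → SU N | ∀ c, V c ∈ T c z}) :=
    (((continuous_apply b).comp_continuousOn hcrit).mono inter_subset_left).inv
  refine (continuous_dist1_SU.comp_continuousOn (hC.mul hΦ)).congr fun V hV => ?_
  exact fluctDev_triChart_eq_of_mem_coarseWindow ν hj T ϑ hT hleft z hV.2 b

/-! ## §3  The margin: on the support of `χ^{(2.9)}_j` along the chart every private coordinate lies STRICTLY inside its window, so `W_z` is a neighbourhood -/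

/-- ★★ **ON THE `χ^{(2.9)}_j`-SUPPORT OF THE CHART, EVERY PRIVATE COORDINATE LIES STRICTLY INSIDE ITS CENTRAL `α`-WINDOW** (STRICT margin `(((d+2)L)²∕4)·ε₀ < α`).
For `V₀ ∈ domAlt_{j+1} ∩ W_z` with `χ^{(2.9)}_j(Φ_tri(V₀,z)) ≠ 0`: `Φ_tri(V₀,z) ∈ domAlt_j` (dag-n09-w4 g3's `hχdom_of_hsolν_of_numerics`: [B11]-existence + numerics), so its
loop variables are `(((d+2)L)²∕4)·ε₀`-small (`self_mem_centralWindow_of_plaqSmall`), and the window is blind to the private coordinates (`centralWindow_extend`); the central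
coordinate of `Φ_tri(V₀,z)` at `c` is `ϑ_c(z, V₀ c)`.  CONDITIONAL on the displayed `hsolν` and numerics.
[cite: Balaban1987RG1, (0.4) p.253, p.259, (2.9) p.266 and p.267; Balaban1985Averaging, (19)–(20) p.21 and Prop. 2 (53) p.26; Balaban1988Convergent, p.265] -/
theorem strictCentralWindow_inverse_of_chi_ne_zero (θ₀ : Stage13Params F N) (g : ℕ → ℝ) (hj : j < K) {α : ℝ}
    (T : PBond (F.P K) (j + 1) → GaugeField (F.P K) j (SU N) → Set (SU N)) (ϑ : PBond (F.P K) (j + 1) → GaugeField (F.P K) j (SU N) → SU N → SU N)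
    (hT : ∀ c U, T c U = (fun g => (avOfRecord F N K j).avg (update U (centralBond c) g) c) ''
        {g : SU N | ∀ i : Idx (F.P K), dist1 (fibreFamily U c (pre U c * g * post U c) i) ≤ α})
    (hleft : ∀ c U g, (∀ i : Idx (F.P K), dist1 (fibreFamily U c (pre U c * g * post U c) i) ≤ α) →
        ϑ c U ((avOfRecord F N K j).avg (update U (centralBond c) g) c) = g)
    (hεreg : 0 < θ₀.ν.εreg) (hε3 : (143 * (((((F.P K).d + 4 : ℕ) : ℝ)) ^ 2 / 4) ^ 2) * θ₀.ν.εreg ≤ 1 / 3)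
    (hε2 : 2 * θ₀.ν.εreg ≤ 2 * deltaSU (Fin N) / ((((F.P K).d + 4) * (F.P K).L : ℕ) : ℝ) ^ 2) (hε29 : 0 ≤ θ₀.ε₂₉)
    (hn1 : 1640 * (2 * (((((F.P K).d + 2) * (F.P K).L : ℕ) : ℝ) * θ₀.ε₂₉) +
        ((((F.P K).d + 2) * (F.P K).L : ℕ) : ℝ) ^ 2 / 4 * (2 * θ₀.ν.εreg / ((F.P K).L : ℝ) ^ 2)) * (((F.P K).L : ℝ) ^ ((F.P K).d - 1)) ^ 2 ≤ 1)
    (hn2 : 13 * (2 * (((((F.P K).d + 2) * (F.P K).L : ℕ) : ℝ) * θ₀.ε₂₉) +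
        ((((F.P K).d + 2) * (F.P K).L : ℕ) : ℝ) ^ 2 / 4 * (2 * θ₀.ν.εreg / ((F.P K).L : ℝ) ^ 2)) * ((F.P K).L : ℝ) ^ ((F.P K).d - 1) < deltaSU (Fin N))
    (hord : 2 * θ₀.ν.εreg / ((F.P K).L : ℝ) ^ 2 +
      4 * max θ₀.ε₂₉ (10 * (((((F.P K).d + 2) * (F.P K).L : ℕ) : ℝ) * θ₀.ε₂₉) * ((F.P K).L : ℝ) ^ ((F.P K).d - 1)) ≤ θ₀.ν.ε₀)
    (hsolν : ∀ j < K, ∀ W ∈ domAltOfRecord F N θ₀.ν K (j + 1), UkExists F N K (j + 1) θ₀.ν.εreg W)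
    (hα : ((((F.P K).d + 2) * (F.P K).L : ℕ) : ℝ) ^ 2 / 4 * θ₀.ν.ε₀ < α)
    {z : GaugeField (F.P K) j (SU N)} {V₀ : PBond (F.P K) (j + 1) → SU N} (hV₀ : V₀ ∈ domAltOfRecord F N θ₀.ν K (j + 1)) (hW : ∀ c, V₀ c ∈ T c z)
    (hχ : chiFixed29 F N θ₀.ν θ₀.ε₂₉ K g j (extend centralBond (fun c => ϑ c z (V₀ c)) z) ≠ 0) (c : PBond (F.P K) (j + 1)) :
    ∀ i : Idx (F.P K), dist1 (fibreFamily z c (pre z c * ϑ c z (V₀ c) * post z c) i) < α := by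
  have havg : (avOfRecord F N K j).avg (extend centralBond (fun c => ϑ c z (V₀ c)) z) ∈ domAltOfRecord F N θ₀.ν K (j + 1) := by
    rw [avOfRecord_triChart_eq_of_mem_coarseWindow hj T ϑ hT hleft z hW]; exact hV₀
  have hdom : (extend centralBond (fun c => ϑ c z (V₀ c)) z : GaugeField (F.P K) j (SU N)) ∈ domAltOfRecord F N θ₀.ν K j := by
    by_contra hnot
    exact hχ (hχdom_of_hsolν_of_numerics θ₀ K g hεreg hε3 hε2 hε29 hn1 hn2 hord hsolν j hj _ havg hnot)
  have hmem := self_mem_centralWindow_of_plaqSmall (succ_le_range_of_lt hj) (ε₀_nonneg_of_hord θ₀ K hεreg hε29 hord)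
    (extend centralBond (fun c => ϑ c z (V₀ c)) z : GaugeField (F.P K) j (SU N)) (show PlaqSmall θ₀.ν.ε₀ _ from hdom) le_rfl c
  rw [centralWindow_extend (succ_le_range_of_lt hj) c _ z (fun c => ϑ c z (V₀ c)), (centralBond_injective_record hj).extend_apply] at hmem
  exact fun i => (hmem i).trans_lt hα

/-- ★★ **… HENCE `W_z` IS A NEIGHBOURHOOD OF `V₀`** under (O-int): every `T_c(z)` is a neighbourhood of `V₀ c` (§1), finitely many `c` (§2).
[cite: Balaban1987RG1, (0.4) p.253, p.259, (2.9)–(2.10) pp.266–267; Balaban1985Averaging, Prop. 2 (53) p.26] -/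
theorem coarseWindow_mem_nhds_of_chi_ne_zero (θ₀ : Stage13Params F N) (g : ℕ → ℝ) (hj : j < K) {α : ℝ}
    (T : PBond (F.P K) (j + 1) → GaugeField (F.P K) j (SU N) → Set (SU N)) (ϑ : PBond (F.P K) (j + 1) → GaugeField (F.P K) j (SU N) → SU N → SU N)
    (hT : ∀ c U, T c U = (fun g => (avOfRecord F N K j).avg (update U (centralBond c) g) c) ''
        {g : SU N | ∀ i : Idx (F.P K), dist1 (fibreFamily U c (pre U c * g * post U c) i) ≤ α})
    (hleft : ∀ c U g, (∀ i : Idx (F.P K), dist1 (fibreFamily U c (pre U c * g * post U c) i) ≤ α) →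
        ϑ c U ((avOfRecord F N K j).avg (update U (centralBond c) g) c) = g)
    (hopen : ∀ (c : PBond (F.P K) (j + 1)) (U : GaugeField (F.P K) j (SU N)) (g : SU N),
      (∀ i : Idx (F.P K), dist1 (fibreFamily U c (pre U c * g * post U c) i) < α) →
        (fun g' => (avOfRecord F N K j).avg (update U (centralBond c) g') c) ''
            {g' : SU N | ∀ i : Idx (F.P K), dist1 (fibreFamily U c (pre U c * g' * post U c) i) ≤ α} ∈
          𝓝 ((avOfRecord F N K j).avg (update U (centralBond c) g) c))
    (hεreg : 0 < θ₀.ν.εreg) (hε3 : (143 * (((((F.P K).d + 4 : ℕ) : ℝ)) ^ 2 / 4) ^ 2) * θ₀.ν.εreg ≤ 1 / 3)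
    (hε2 : 2 * θ₀.ν.εreg ≤ 2 * deltaSU (Fin N) / ((((F.P K).d + 4) * (F.P K).L : ℕ) : ℝ) ^ 2) (hε29 : 0 ≤ θ₀.ε₂₉)
    (hn1 : 1640 * (2 * (((((F.P K).d + 2) * (F.P K).L : ℕ) : ℝ) * θ₀.ε₂₉) +
        ((((F.P K).d + 2) * (F.P K).L : ℕ) : ℝ) ^ 2 / 4 * (2 * θ₀.ν.εreg / ((F.P K).L : ℝ) ^ 2)) * (((F.P K).L : ℝ) ^ ((F.P K).d - 1)) ^ 2 ≤ 1)
    (hn2 : 13 * (2 * (((((F.P K).d + 2) * (F.P K).L : ℕ) : ℝ) * θ₀.ε₂₉) +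
        ((((F.P K).d + 2) * (F.P K).L : ℕ) : ℝ) ^ 2 / 4 * (2 * θ₀.ν.εreg / ((F.P K).L : ℝ) ^ 2)) * ((F.P K).L : ℝ) ^ ((F.P K).d - 1) < deltaSU (Fin N))
    (hord : 2 * θ₀.ν.εreg / ((F.P K).L : ℝ) ^ 2 +
      4 * max θ₀.ε₂₉ (10 * (((((F.P K).d + 2) * (F.P K).L : ℕ) : ℝ) * θ₀.ε₂₉) * ((F.P K).L : ℝ) ^ ((F.P K).d - 1)) ≤ θ₀.ν.ε₀)
    (hsolν : ∀ j < K, ∀ W ∈ domAltOfRecord F N θ₀.ν K (j + 1), UkExists F N K (j + 1) θ₀.ν.εreg W)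
    (hα : ((((F.P K).d + 2) * (F.P K).L : ℕ) : ℝ) ^ 2 / 4 * θ₀.ν.ε₀ < α)
    {z : GaugeField (F.P K) j (SU N)} {V₀ : PBond (F.P K) (j + 1) → SU N} (hV₀ : V₀ ∈ domAltOfRecord F N θ₀.ν K (j + 1)) (hW : ∀ c, V₀ c ∈ T c z)
    (hχ : chiFixed29 F N θ₀.ν θ₀.ε₂₉ K g j (extend centralBond (fun c => ϑ c z (V₀ c)) z) ≠ 0) :
    {V : PBond (F.P K) (j + 1) → SU N | ∀ c, V c ∈ T c z} ∈ 𝓝 V₀ :=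
  coarseWindow_mem_nhds T z fun c => imageWindow_mem_nhds_of_windowOpenness T ϑ hT hleft hopen (hW c)
    (strictCentralWindow_inverse_of_chi_ne_zero θ₀ g hj T ϑ hT hleft hεreg hε3 hε2 hε29 hn1 hn2 hord hsolν hα hV₀ hW hχ c)

end Summit.QuantumFields.YangMills.BalabanUVNodes.N09StrictWindowMarginAtRecord

end
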